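import Literature.Combinatorics.Optimization.ShellLawWeightedLevelStep
import Literature.Combinatorics.Optimization.ShellLawSmoothing
import Mathlib.Algebra.Polynomial.AlgebraMap
import HarnessLib

/-!
# Weighted shell LAWS: the normalised level step, its iteration, and the abstract `ℓ¹`-type bound

The weighted / multi-block twin of `ShellLawSmoothing.lean` (prover g21), on top of
`ShellLawWeightedLevelStep.lean` (lit g32/g33).  Fix a perfect matching (`π` its partner involution,
fixed-point-free), a `π`-stable ground set `S`, vertex weights `ω : Fin n → R` with values in a commutative
`ℝ`-algebra `R` (one block: `R = ℝ[X]`, `ω = X^{[·∈H]}`; two blocks: `R = ℝ[X₁,X₂]`,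
`ω = X₁^{[·∈H₁]}X₂^{[·∈H₂]}`).  The weighted shell LAW profile is

  `w̄_S(T,c) := |Shell_S(T,c)|⁻¹ • W_S(T,c)`,  `W_S(T,c) = Σ_{U∈Shell_S(T,c)} Π_{u∈U} ω u`   (`wlaw`, `wsum`);

for one block its `x`-th coefficient is the shell law `law_S(T,c;x)` of `|U∩H|`, for two blocks its
`(x₁,x₂)`-coefficient is the joint shell law of `(|U∩H₁|, |U∩H₂|)`.

* §1 `wlaw`, `wdelIterLaw` (the deletion recursion on LAWS:
  `D̄_0(S) = w̄_S(t,·)`, `D̄_{m+1}(S) = Σ_{p∈S}Σ_{q∈S∖e_p} (ω p − ω q)(ω πp − ω πq) • D̄_m(S∖e_p∖e_q)`),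
  the normalisers `lnorm M = 1/(2M(M−2))`, `lnormProd M k = Π_{i<k} lnorm (M − 4i)`.
* §2 **`wlaw_step`** — THE NORMALISED LEVEL STEP: if `Shell_S(t+2,c+2) ≠ ∅`,
  `w̄_S(t+2,c+2) − w̄_S(t+2,c) = −(1/(2|S|(|S|−2))) • Σ_{p∈S}Σ_{q∈S∖e_p} (ω p − ω q)(ω πp − ω πq) • w̄_{S∖e_p∖e_q}(t,c)`
  (`wLevelStep_two_mul` divided by the common normaliser `(c+2)(c+1)|Shell_S(t+2,c+2)| =
  (t+2−c)(|S|−t−2−c)|Shell_S(t+2,c)| = |S|(|S|−2)·|Shell_{S∖2e}(t,c)|`, `shellStepIn_card`,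
  `card_shellIn_del2_ratio`).  One block: `levelStep_shellLaw` after coefficient extraction.
* §3 linearity of `(Δ_{(2)})^k` on `R`-valued profiles and **`fwdDiff_iter_wlaw_eq`**: if
  `Shell_S(t+2k,c+2k) ≠ ∅`, `(Δ_{(2)})^k [w̄_S(t+2k,·)](c) = ((−1)^k · Π_{i<k} (2(|S|−4i)(|S|−4i−2))⁻¹) • D̄_k(S)(t,·)(c)`.
* §4 **`seminorm_fwdDiff_iter_wlaw_le`** — THE ABSTRACT ITERATED BOUND: for every `ν : R → ℝ` that is
  subadditive and absolutely `ℝ`-homogeneous (`ν(r•x) = |r|·ν x`), every `g₀ ∈ R`, `ρ, B ≥ 0`: if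
  (i) every `π`-stable `S′ ⊆ S` with `|S′| > |S| − 4k` has at most `2ρ|S′|(|S′|−2)` ordered off-edge pairs
  `(p,q)` with `(ω p − ω q)(ω πp − ω πq) ≠ 0`, and (ii) every `π`-stable `S′ ⊆ S` with `|S′| = |S| − 4k` has
  `ν(g₀ · f_1⋯f_k · w̄_{S′}(t,c)) ≤ B` for every list of `k` weight-difference factors `f_i = (ω p_i − ω q_i)(ω πp_i − ω πq_i)`,
  then `ν(g₀ · (Δ_{(2)})^k[w̄_S(t+2k,·)](c)) ≤ ρ^k · B`.  One block (`ν = Σ_{x∈X}|coeff_x|`, factors `±(1−X)²`,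
  `g₀ = (1−X)^{2j}`): the shape of `ShellLawSmoothing.sum_abs_nab2_iter_fwdDiff_iter_le`; two blocks: `ν` the `ℓ¹`
  norm of the bivariate coefficients, factors `(1−X_i)²`, `(X₁−X₂)²`, `(1−X₁)(1−X₂)`, … (cell pnp-psdrank, CG2SYM).

All PROVED, 0 sorry; the definitions are the four bookkeeping objects of §1; no named facts.  The bivariate
`x`-smoothness input `B` (mixed differences of two-block joint shell laws) is NOT here.

## References
* [Rothvoss2017] T. Rothvoß, *The matching polytope has exponential extension complexity*, J. ACM 64
  (2017), §2 (PDF pp. 5–6): cuts, crossing numbers, the level classes.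
* [RollinRoss2010] A. Röllin, N. Ross, *Local limit theorems via Landau–Kolmogorov inequalities*,
  Bernoulli 21 (2015), §3 (the `ℓ¹` smoothness functionals; Lemma 3.4 is dimension-free).
* [GodsilMeagher2015] C. Godsil, K. Meagher, *Erdős–Ko–Rado Theorems: Algebraic Approaches*, CUP 2015, §15.2.
-/

noncomputable section

open Finset

namespace Literature.Combinatorics.Optimization

namespace ShellStep

variable {n : ℕ} {π : Fin n → Fin n} {R : Type*} [CommRing R] [Algebra ℝ R]

/-! ### §1 Weighted shell laws, the deletion recursion on laws, the normalisers -/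

section Defs

variable (π)

/-- The weighted shell LAW profile `c ↦ w̄_S(T,c) = |Shell_S(T,c)|⁻¹ • Σ_{U∈Shell_S(T,c)} Π_{u∈U} ω u`
(the zero profile on empty shells). [cite: Rothvoss2017, §2 (PDF p. 6)] -/
def wlaw (ω : Fin n → R) (S : Finset (Fin n)) (T : ℕ) : ℕ → R :=
  fun c => ((shellIn π S T c).card : ℝ)⁻¹ • wsum π ω S T c

/-- The `m`-fold weighted deletion profile of LAWS at cut size `t`: `D̄_0(S) = w̄_S(t,·)`,
`D̄_{m+1}(S) = Σ_{p∈S} Σ_{q∈S∖e_p} (ω p − ω q)(ω πp − ω πq) • D̄_m(S∖e_p∖e_q)`.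
[cite: Rothvoss2017, §2 (PDF p. 6)] -/
def wdelIterLaw (ω : Fin n → R) (t : ℕ) : ℕ → Finset (Fin n) → (ℕ → R)
  | 0, S => wlaw π ω S t
  | m + 1, S => ∑ p ∈ S, ∑ q ∈ S \ {p, π p},
      ((ω p - ω q) * (ω (π p) - ω (π q))) • wdelIterLaw ω t m (del2 π S p q)

variable {π}

/-- The level-step normaliser `κ(M) = 1/(2M(M−2))` of a ground set of size `M`. [cite: Rothvoss2017, §2 (PDF p. 6)] -/
def lnorm (M : ℕ) : ℝ := 1 / (2 * (M : ℝ) * ((M : ℝ) - 2))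

/-- The `k`-fold normaliser `Π_{i<k} κ(M − 4i)` (each two-edge deletion removes four vertices).
[cite: Rothvoss2017, §2 (PDF p. 6)] -/
def lnormProd : ℕ → ℕ → ℝ
  | _, 0 => 1
  | M, k + 1 => lnorm M * lnormProd (M - 4) k

/-- `w̄_S(T,c)` unfolded. [cite: Rothvoss2017, §2 (PDF p. 6)] -/
theorem wlaw_apply (ω : Fin n → R) (S : Finset (Fin n)) (T c : ℕ) :
    wlaw π ω S T c = ((shellIn π S T c).card : ℝ)⁻¹ • wsum π ω S T c := rfl

/-- `D̄_0(S) = w̄_S(t,·)`. [cite: Rothvoss2017, §2 (PDF p. 6)] -/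
@[simp] theorem wdelIterLaw_zero (ω : Fin n → R) (t : ℕ) (S : Finset (Fin n)) :
    wdelIterLaw π ω t 0 S = wlaw π ω S t := rfl

/-- `D̄_{m+1}(S)` by one more two-edge deletion (outermost first). [cite: Rothvoss2017, §2 (PDF p. 6)] -/
@[simp] theorem wdelIterLaw_succ (ω : Fin n → R) (t m : ℕ) (S : Finset (Fin n)) :
    wdelIterLaw π ω t (m + 1) S = ∑ p ∈ S, ∑ q ∈ S \ {p, π p},
      ((ω p - ω q) * (ω (π p) - ω (π q))) • wdelIterLaw π ω t m (del2 π S p q) := rfl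

/-- No deletion: normaliser `1`. [cite: Rothvoss2017, §2 (PDF p. 6)] -/
@[simp] theorem lnormProd_zero (M : ℕ) : lnormProd M 0 = 1 := by
  cases M <;> rfl

/-- One more deletion. [cite: Rothvoss2017, §2 (PDF p. 6)] -/
@[simp] theorem lnormProd_succ (M k : ℕ) : lnormProd M (k + 1) = lnorm M * lnormProd (M - 4) k := rfl

/-- `κ(M) > 0` for `M ≥ 3`. [cite: Rothvoss2017, §2 (PDF p. 6)] -/
theorem lnorm_pos {M : ℕ} (hM : 3 ≤ M) : 0 < lnorm M := by
  have h3 : (3 : ℝ) ≤ M := by exact_mod_cast hM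
  unfold lnorm
  exact div_pos one_pos (mul_pos (mul_pos two_pos (by linarith)) (by linarith))

/-- `W_S(T,c) = |Shell_S(T,c)| • w̄_S(T,c)` (also on empty shells). [cite: Rothvoss2017, §2 (PDF p. 6)] -/
theorem wsum_eq_card_smul_wlaw (ω : Fin n → R) (S : Finset (Fin n)) (T c : ℕ) :
    wsum π ω S T c = ((shellIn π S T c).card : ℝ) • wlaw π ω S T c := by
  rw [wlaw_apply]
  by_cases h0 : ((shellIn π S T c).card : ℝ) = 0
  · have hc : shellIn π S T c = ∅ := card_eq_zero.1 (by exact_mod_cast h0)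
    rw [h0, zero_smul, wsum_apply, hc, sum_empty]
  · rw [smul_inv_smul₀ h0]

end Defs

/-! ### §2 The normalised level step for weighted laws -/

section Step

variable (hπ : ∀ v, π (π v) = v) (hπ' : ∀ v, π v ≠ v)
include hπ hπ'

omit hπ hπ' in
/-- Real scalars act through `algebraMap`: a natural-number cast in `R` times `x` is the real cast acting on `x`.
[folklore] -/
private theorem natCast_mul_eq_smul (m : ℕ) (x : R) : (m : R) * x = (m : ℝ) • x := by
  rw [Algebra.smul_def, map_natCast]

omit hπ hπ' in
/-- `algebraMap ℝ R` on the level-step coefficients. [folklore] -/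
private theorem coeff_mul_eq_smul (a : ℝ) (x : R) : algebraMap ℝ R a * x = a • x := (Algebra.smul_def a x).symm

omit hπ hπ' in
/-- `2·x` in `R` is the real scalar `2` acting. [folklore] -/
private theorem two_mul_eq_smul (x : R) : (2 : R) * x = (2 : ℝ) • x := by
  rw [Algebra.smul_def, map_ofNat]

/-- **The normalised level step for weighted shell laws.**  If `Shell_S(t+2,c+2) ≠ ∅` then
`w̄_S(t+2,c+2) − w̄_S(t+2,c) = −κ(|S|) • Σ_{p∈S} Σ_{q∈S∖e_p} (ω p − ω q)(ω πp − ω πq) • w̄_{S∖e_p∖e_q}(t,c)`,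
`κ(M) = 1/(2M(M−2))`.  (One block: `ShellLawLevelStep.levelStep_shellLaw` after coefficient extraction.)
[cite: Rothvoss2017, §2 (PDF p. 6)] -/
theorem wlaw_step {S : Finset (Fin n)} (hS : ∀ v ∈ S, π v ∈ S) (ω : Fin n → R) (t c : ℕ)
    (hne : (shellIn π S (t + 2) (c + 2)).Nonempty) :
    wlaw π ω S (t + 2) (c + 2) - wlaw π ω S (t + 2) c =
      (-lnorm S.card) • ∑ p ∈ S, ∑ q ∈ S \ {p, π p},
        ((ω p - ω q) * (ω (π p) - ω (π q))) • wlaw π ω (del2 π S p q) t c := by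
  -- sizes
  have hS4 : t + 2 + (c + 2) ≤ S.card := by
    obtain ⟨U, hU⟩ := hne; exact add_le_of_mem_shellIn hπ hS hU
  have h4 : (4 : ℝ) ≤ S.card := by
    have : 4 ≤ S.card := by omega
    exact_mod_cast this
  have hden : 0 < (S.card : ℝ) * ((S.card : ℝ) - 2) := mul_pos (by linarith) (by linarith)
  have hA : (0 : ℝ) < (shellIn π S (t + 2) (c + 2)).card := by exact_mod_cast hne.card_pos
  -- the common normaliser `K`
  set K : ℝ := ((c : ℝ) + 2) * ((c : ℝ) + 1) * (shellIn π S (t + 2) (c + 2)).card with hK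
  have hKpos : 0 < K := by positivity
  have hKB : K = ((t : ℝ) + 2 - c) * ((S.card : ℝ) - t - 2 - c) * (shellIn π S (t + 2) c).card := by
    have h := shellStepIn_card hπ hπ' hS (t + 2) c
    push_cast at h
    rw [hK, h]; ring
  have hdel : ∀ p ∈ S, ∀ q ∈ S \ {p, π p},
      ((shellIn π (del2 π S p q) t c).card : ℝ) = K / ((S.card : ℝ) * ((S.card : ℝ) - 2)) := by
    intro p hp q hq
    rw [mem_sdiff, mem_insert, mem_singleton, not_or] at hq
    have hr := card_shellIn_del2_ratio hπ hπ' hS hp hq.1 hq.2.1 hq.2.2 t c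
    rw [eq_div_iff hden.ne', hKB]
    linarith [hr]
  -- the weighted level step, rewritten with real scalars acting on laws
  have hmain := wLevelStep_two_mul hπ hπ' hS ω t c
  have e2 : ((c : R) + 2) * ((c : R) + 1) * ∑ U ∈ shellIn π S (t + 2) (c + 2), ∏ u ∈ U, ω u =
      K • wlaw π ω S (t + 2) (c + 2) := by
    rw [← wsum_apply, wsum_eq_card_smul_wlaw, hK, mul_smul, mul_smul,
      show ((c : R) + 2) * ((c : R) + 1) = algebraMap ℝ R (((c : ℝ) + 2) * ((c : ℝ) + 1)) by
        simp only [map_mul, map_add, map_natCast, map_ofNat, map_one],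
      coeff_mul_eq_smul, mul_smul]
  have e0 : ((t : R) + 2 - c) * ((S.card : R) - t - 2 - c) * ∑ U ∈ shellIn π S (t + 2) c, ∏ u ∈ U, ω u =
      K • wlaw π ω S (t + 2) c := by
    rw [← wsum_apply, wsum_eq_card_smul_wlaw, hKB, mul_smul, mul_smul,
      show ((t : R) + 2 - c) * ((S.card : R) - t - 2 - c) =
        algebraMap ℝ R (((t : ℝ) + 2 - c) * ((S.card : ℝ) - t - 2 - c)) by
        simp only [map_mul, map_add, map_sub, map_natCast, map_ofNat],
      coeff_mul_eq_smul, mul_smul]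
  have epq : ∀ p ∈ S, ∀ q ∈ S \ {p, π p},
      (ω p - ω q) * (ω (π p) - ω (π q)) * ∑ U ∈ shellIn π (del2 π S p q) t c, ∏ u ∈ U, ω u =
        (K / ((S.card : ℝ) * ((S.card : ℝ) - 2))) •
          (((ω p - ω q) * (ω (π p) - ω (π q))) • wlaw π ω (del2 π S p q) t c) := by
    intro p hp q hq
    rw [← wsum_apply, wsum_eq_card_smul_wlaw, hdel p hp q hq, smul_eq_mul, mul_smul_comm]
  have hR : ∑ p ∈ S, ∑ q ∈ S \ {p, π p},
      (ω p - ω q) * (ω (π p) - ω (π q)) * ∑ U ∈ shellIn π (del2 π S p q) t c, ∏ u ∈ U, ω u =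
        (K / ((S.card : ℝ) * ((S.card : ℝ) - 2))) • ∑ p ∈ S, ∑ q ∈ S \ {p, π p},
          ((ω p - ω q) * (ω (π p) - ω (π q))) • wlaw π ω (del2 π S p q) t c := by
    rw [Finset.smul_sum]
    refine sum_congr rfl fun p hp => ?_
    rw [Finset.smul_sum]
    exact sum_congr rfl fun q hq => epq p hp q hq
  rw [e2, e0, hR, ← smul_sub, two_mul_eq_smul, smul_smul, ← neg_smul] at hmain
  -- `hmain : (2K) • (w̄₂ − w̄₀) = (−(K/(|S|(|S|−2)))) • Σ`; divide by `2K`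
  have h2K : (2 : ℝ) * K ≠ 0 := by positivity
  have hD : wlaw π ω S (t + 2) (c + 2) - wlaw π ω S (t + 2) c =
      (((2 : ℝ) * K)⁻¹ * -(K / ((S.card : ℝ) * ((S.card : ℝ) - 2)))) • ∑ p ∈ S, ∑ q ∈ S \ {p, π p},
        ((ω p - ω q) * (ω (π p) - ω (π q))) • wlaw π ω (del2 π S p q) t c := by
    rw [← smul_smul, ← hmain, inv_smul_smul₀ h2K]
  rw [hD]
  congr 1
  have hS0 : (S.card : ℝ) ≠ 0 := ne_of_gt (by linarith)
  have hS2 : (S.card : ℝ) - 2 ≠ 0 := ne_of_gt (by linarith)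
  unfold lnorm
  field_simp

/-- Profile form of the normalised level step on an initial segment of levels: for `i ≤ k` and
`Shell_S(t+2,c+2k+2) ≠ ∅`, `Δ_{(2)}[w̄_S(t+2,·)](c+2i) = (−κ(|S|) • D̄_1(S)(t,·))(c+2i)`.
[cite: Rothvoss2017, §2 (PDF p. 6)] -/
theorem fwdDiff_wlaw_eq {S : Finset (Fin n)} (hS : ∀ v ∈ S, π v ∈ S) (ω : Fin n → R)
    (t c k : ℕ) (hne : (shellIn π S (t + 2) (c + 2 * k + 2)).Nonempty) (i : ℕ) (hi : i ≤ k) :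
    fwdDiff 2 (wlaw π ω S (t + 2)) (c + 2 * i) = ((-lnorm S.card) • wdelIterLaw π ω t 1 S) (c + 2 * i) := by
  have hne' : (shellIn π S (t + 2) (c + 2 * i + 2)).Nonempty := by
    refine shellIn_nonempty_of_le hπ hπ' hS (k - i) ?_
    rw [show c + 2 * i + 2 + 2 * (k - i) = c + 2 * k + 2 by omega]
    exact hne
  simp only [fwdDiff, wdelIterLaw_succ, wdelIterLaw_zero, Pi.smul_apply, Finset.sum_apply]
  rw [show c + 2 * i + 2 = (c + 2 * i) + 2 by ring]
  exact wlaw_step hπ hπ' hS ω t (c + 2 * i) hne'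

end Step

/-! ### §3 Linearity of `(Δ_{(2)})^k` on `R`-valued level profiles; the iterated identity -/

section Operators

omit [Algebra ℝ R] in
/-- `(Δ_{(2)})^k P` at level `c` depends only on `P` at the levels `c + 2i`, `i ≤ k`.
[cite: Rothvoss2017, §2 (PDF p. 6)] -/
theorem fwdDiff_iter_congr_of_le (k : ℕ) {P Q : ℕ → R} {c : ℕ}
    (h : ∀ i, i ≤ k → P (c + 2 * i) = Q (c + 2 * i)) :
    (fwdDiff 2)^[k] P c = (fwdDiff 2)^[k] Q c := by
  rw [fwdDiff_iter_eq_sum_shift, fwdDiff_iter_eq_sum_shift]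
  refine sum_congr rfl fun i hi => ?_
  rw [show c + i • 2 = c + 2 * i by rw [smul_eq_mul]; ring, h i (Nat.lt_succ_iff.1 (mem_range.1 hi))]

omit [Algebra ℝ R] in
/-- `(Δ_{(2)})^k` of a finite sum of profiles. [cite: Rothvoss2017, §2 (PDF p. 6)] -/
theorem fwdDiff_iter_finset_sum {ι : Type*} (k : ℕ) (s : Finset ι) (P : ι → ℕ → R) :
    (fwdDiff 2)^[k] (∑ i ∈ s, P i) = ∑ i ∈ s, (fwdDiff 2)^[k] (P i) := by
  induction k generalizing P with
  | zero => rfl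
  | succ k ih =>
      rw [Function.iterate_succ_apply]
      have h1 : fwdDiff 2 (∑ i ∈ s, P i) = ∑ i ∈ s, fwdDiff 2 (P i) := by
        funext c
        simp only [fwdDiff, Finset.sum_apply, sum_sub_distrib]
      rw [h1, ih]
      rfl

omit [Algebra ℝ R] in
/-- `(Δ_{(2)})^k` commutes with constant `R`-multiples. [cite: Rothvoss2017, §2 (PDF p. 6)] -/
theorem fwdDiff_iter_const_smul (k : ℕ) (f : R) (P : ℕ → R) :
    (fwdDiff 2)^[k] (f • P) = f • (fwdDiff 2)^[k] P := by
  induction k generalizing P with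
  | zero => rfl
  | succ k ih =>
      rw [Function.iterate_succ_apply, Function.iterate_succ_apply, ← ih]
      congr 1
      funext c
      simp only [fwdDiff, Pi.smul_apply, smul_eq_mul]
      ring

/-- `(Δ_{(2)})^k` commutes with real scalars. [cite: Rothvoss2017, §2 (PDF p. 6)] -/
theorem fwdDiff_iter_real_smul (k : ℕ) (r : ℝ) (P : ℕ → R) :
    (fwdDiff 2)^[k] (r • P) = r • (fwdDiff 2)^[k] P := by
  induction k generalizing P with
  | zero => rfl
  | succ k ih =>
      rw [Function.iterate_succ_apply, Function.iterate_succ_apply, ← ih]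
      congr 1
      funext c
      simp only [fwdDiff, Pi.smul_apply, smul_sub]

end Operators

section Iterated

variable (hπ : ∀ v, π (π v) = v) (hπ' : ∀ v, π v ≠ v)
include hπ hπ'

/-- One step of the iteration, pushed through `(Δ_{(2)})^k`: if `Shell_S(t+2k+2, c+2k+2) ≠ ∅` then
`(Δ_{(2)})^{k+1}[w̄_S(t+2k+2,·)](c) = −κ(|S|) • Σ_{p∈S}Σ_{q∈S∖e_p} f_{pq} • (Δ_{(2)})^k[w̄_{S∖e_p∖e_q}(t+2k,·)](c)`.
[cite: Rothvoss2017, §2 (PDF p. 6)] -/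
theorem fwdDiff_iter_succ_wlaw_eq {S : Finset (Fin n)} (hS : ∀ v ∈ S, π v ∈ S) (ω : Fin n → R)
    (t k c : ℕ) (hne : (shellIn π S (t + 2 * (k + 1)) (c + 2 * (k + 1))).Nonempty) :
    (fwdDiff 2)^[k + 1] (wlaw π ω S (t + 2 * (k + 1))) c =
      (-lnorm S.card) • ∑ p ∈ S, ∑ q ∈ S \ {p, π p},
        ((ω p - ω q) * (ω (π p) - ω (π q))) • (fwdDiff 2)^[k] (wlaw π ω (del2 π S p q) (t + 2 * k)) c := by
  set T := t + 2 * k with hT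
  have hTop : t + 2 * (k + 1) = T + 2 := by rw [hT]; ring
  have hne' : (shellIn π S (T + 2) (c + 2 * k + 2)).Nonempty := by
    rw [← hTop, show c + 2 * k + 2 = c + 2 * (k + 1) by ring]; exact hne
  have hstep : (fwdDiff 2)^[k + 1] (wlaw π ω S (t + 2 * (k + 1))) c =
      (fwdDiff 2)^[k] ((-lnorm S.card) • wdelIterLaw π ω T 1 S) c := by
    rw [Function.iterate_succ_apply]
    refine fwdDiff_iter_congr_of_le k fun i hi => ?_
    rw [hTop]
    exact fwdDiff_wlaw_eq hπ hπ' hS ω T c k hne' i hi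
  rw [hstep, fwdDiff_iter_real_smul, wdelIterLaw_succ, fwdDiff_iter_finset_sum, Pi.smul_apply,
    Finset.sum_apply]
  congr 1
  refine sum_congr rfl fun p _ => ?_
  rw [fwdDiff_iter_finset_sum, Finset.sum_apply]
  refine sum_congr rfl fun q _ => ?_
  rw [fwdDiff_iter_const_smul, wdelIterLaw_zero, Pi.smul_apply]

/-- **`k` NORMALISED LEVEL STEPS** (the iterated identity for weighted laws): if `Shell_S(t+2k,c+2k) ≠ ∅` then
`(Δ_{(2)})^k [w̄_S(t+2k,·)](c) = ((−1)^k · Π_{i<k} κ(|S|−4i)) • D̄_k(S)(t,·)(c)` — the `k`-th level difference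
(step `2`) of the weighted shell law at cut size `t+2k` is, up to the explicit normaliser, the signed sum over
sequences of `k` ordered off-edge pairs of the products of the `k` weight-difference factors acting on the
weighted shell laws at cut size `t` of the `2k`-edge-deleted ground sets. [cite: Rothvoss2017, §2 (PDF p. 6)] -/
theorem fwdDiff_iter_wlaw_eq (ω : Fin n → R) (t : ℕ) :
    ∀ (k : ℕ) {S : Finset (Fin n)}, (∀ v ∈ S, π v ∈ S) → ∀ (c : ℕ),
      (shellIn π S (t + 2 * k) (c + 2 * k)).Nonempty →
      (fwdDiff 2)^[k] (wlaw π ω S (t + 2 * k)) c =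
        (((-1 : ℝ) ^ k) * lnormProd S.card k) • wdelIterLaw π ω t k S c := by
  intro k
  induction k with
  | zero => intro S _ c _; simp
  | succ k ih =>
      intro S hS c hne
      rw [fwdDiff_iter_succ_wlaw_eq hπ hπ' hS ω t k c hne, wdelIterLaw_succ, Finset.sum_apply, Finset.smul_sum,
        Finset.smul_sum]
      refine sum_congr rfl fun p hp => ?_
      rw [Finset.sum_apply, Finset.smul_sum, Finset.smul_sum]
      refine sum_congr rfl fun q hq => ?_
      have hq' := hq
      rw [mem_sdiff, mem_insert, mem_singleton, not_or] at hq'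
      have hne2 : (shellIn π (del2 π S p q) (t + 2 * k) (c + 2 * k)).Nonempty := by
        refine shellIn_del2_nonempty hπ hπ' hS ?_ hp hq'.1 hq'.2.1 hq'.2.2
        rw [show t + 2 * k + 2 = t + 2 * (k + 1) by ring, show c + 2 * k + 2 = c + 2 * (k + 1) by ring]
        exact hne
      have hcard : (del2 π S p q).card = S.card - 4 := by
        have := card_del2_add_four hπ hπ' hS hp hq'.1 hq'.2.1 hq'.2.2
        omega
      rw [ih (del2_stable hπ hS p q) c hne2, hcard, Pi.smul_apply, lnormProd_succ,
        smul_comm ((ω p - ω q) * (ω (π p) - ω (π q))) (((-1 : ℝ) ^ k) * lnormProd (S.card - 4) k), smul_smul]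
      congr 1
      ring

end Iterated

/-! ### §4 The abstract iterated bound for a subadditive, absolutely homogeneous functional -/

section Bound

variable (hπ : ∀ v, π (π v) = v) (hπ' : ∀ v, π v ≠ v)
include hπ hπ'

omit hπ hπ' in
/-- A subadditive absolutely homogeneous functional vanishes at `0`. [cite: RollinRoss2010, §3] -/
theorem seminormLike_zero {ν : R → ℝ} (hsmul : ∀ (r : ℝ) (x : R), ν (r • x) = |r| * ν x) : ν 0 = 0 := by
  have := hsmul 0 0
  rwa [zero_smul, abs_zero, zero_mul] at this

omit hπ hπ' in
/-- … and is subadditive over finite sums. [cite: RollinRoss2010, §3] -/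
theorem seminormLike_sum_le {ν : R → ℝ} (hadd : ∀ x y : R, ν (x + y) ≤ ν x + ν y)
    (hsmul : ∀ (r : ℝ) (x : R), ν (r • x) = |r| * ν x) {ι : Type*} (s : Finset ι) (F : ι → R) :
    ν (∑ i ∈ s, F i) ≤ ∑ i ∈ s, ν (F i) := by
  classical
  induction s using Finset.induction_on with
  | empty => simp [seminormLike_zero hsmul]
  | insert a s ha ih =>
      rw [sum_insert ha, sum_insert ha]
      exact (hadd _ _).trans (by linarith)

/-- **THE ABSTRACT ITERATED BOUND.**  Let `ν : R → ℝ` be subadditive and absolutely `ℝ`-homogeneous, `g₀ ∈ R`,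
`ρ, B ≥ 0`, `k ∈ ℕ`, `S` a `π`-stable ground set with `Shell_S(t+2k,c+2k) ≠ ∅`.  Suppose
(i) every `π`-stable `S′ ⊆ S` with `|S| < |S′| + 4k` has
  `Σ_{p∈S′} #{q ∈ S′∖e_p : (ω p − ω q)(ω πp − ω πq) ≠ 0} ≤ 2ρ·|S′|(|S′|−2)`, and
(ii) every `π`-stable `S′ ⊆ S` with `|S′| + 4k = |S|` and every list `l` of `k` weight-difference factors
  (each of the form `(ω p − ω q)(ω πp − ω πq)`) has `ν(g₀ · l.prod · w̄_{S′}(t,c)) ≤ B`.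
Then `ν(g₀ · (Δ_{(2)})^k[w̄_S(t+2k,·)](c)) ≤ ρ^k · B`.
(Induction on `k`: `fwdDiff_iter_succ_wlaw_eq`, subadditivity over the pairs with non-zero factor, `κ(|S|)·2ρ|S|(|S|−2) = ρ`,
and the induction hypothesis on each deleted ground set with `g₀ ↦ g₀·f_{pq}`.)
[cite: Rothvoss2017, §2 (PDF p. 6)] [cite: RollinRoss2010, §3 (Lemma 3.1/3.4: `ℓ¹` smoothness functionals)] -/
theorem seminorm_fwdDiff_iter_wlaw_le [DecidableEq R] {ν : R → ℝ} (hadd : ∀ x y : R, ν (x + y) ≤ ν x + ν y)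
    (hsmul : ∀ (r : ℝ) (x : R), ν (r • x) = |r| * ν x) (ω : Fin n → R) (t : ℕ) {ρ B : ℝ}
    (hρ0 : 0 ≤ ρ) (hB0 : 0 ≤ B) :
    ∀ (k : ℕ) (g₀ : R) {S : Finset (Fin n)}, (∀ v ∈ S, π v ∈ S) → ∀ (c : ℕ),
      (shellIn π S (t + 2 * k) (c + 2 * k)).Nonempty →
      (∀ S' ⊆ S, (∀ v ∈ S', π v ∈ S') → S.card < S'.card + 4 * k →
        (∑ p ∈ S', (((S' \ {p, π p}).filter
            (fun q => (ω p - ω q) * (ω (π p) - ω (π q)) ≠ 0)).card : ℝ)) ≤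
          2 * ρ * ((S'.card : ℝ) * ((S'.card : ℝ) - 2))) →
      (∀ S' ⊆ S, (∀ v ∈ S', π v ∈ S') → S'.card + 4 * k = S.card →
        ∀ l : List R, l.length = k →
          (∀ g ∈ l, ∃ p q : Fin n, g = (ω p - ω q) * (ω (π p) - ω (π q))) →
          ν (g₀ * l.prod * wlaw π ω S' t c) ≤ B) →
      ν (g₀ * (fwdDiff 2)^[k] (wlaw π ω S (t + 2 * k)) c) ≤ ρ ^ k * B := by
  intro k
  induction k with
  | zero =>
      intro g₀ S hS c _ _ hB
      have := hB S (Subset.refl S) hS (by simp) [] rfl (by simp)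
      simpa using this
  | succ k ih =>
      intro g₀ S hS c hne hρ hB
      -- sizes and the normaliser
      have hS4 : t + 2 * (k + 1) + (c + 2 * (k + 1)) ≤ S.card := by
        obtain ⟨U, hU⟩ := hne; exact add_le_of_mem_shellIn hπ hS hU
      have h4 : (4 : ℝ) ≤ S.card := by
        have : 4 ≤ S.card := by omega
        exact_mod_cast this
      have hκ0 : 0 < lnorm S.card := lnorm_pos (by omega)
      -- expand one step: `g₀ · Δ^{k+1} w̄_S = −κ • Σ_p Σ_q (g₀ f_{pq}) · Δ^k w̄_{S_pq}`
      have hexp : g₀ * (fwdDiff 2)^[k + 1] (wlaw π ω S (t + 2 * (k + 1))) c =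
          (-lnorm S.card) • ∑ p ∈ S, ∑ q ∈ S \ {p, π p},
            (g₀ * ((ω p - ω q) * (ω (π p) - ω (π q)))) *
              (fwdDiff 2)^[k] (wlaw π ω (del2 π S p q) (t + 2 * k)) c := by
        rw [fwdDiff_iter_succ_wlaw_eq hπ hπ' hS ω t k c hne, mul_smul_comm, mul_sum]
        congr 1
        refine sum_congr rfl fun p _ => ?_
        rw [mul_sum]
        refine sum_congr rfl fun q _ => ?_
        rw [smul_eq_mul, ← mul_assoc]
      -- the induction hypothesis on each deleted ground set, with `g₀ ↦ g₀·f_{pq}`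
      have hIH : ∀ p ∈ S, ∀ q ∈ S \ {p, π p},
          ν ((g₀ * ((ω p - ω q) * (ω (π p) - ω (π q)))) *
              (fwdDiff 2)^[k] (wlaw π ω (del2 π S p q) (t + 2 * k)) c) ≤ ρ ^ k * B := by
        intro p hp q hq
        have hq' := hq
        rw [mem_sdiff, mem_insert, mem_singleton, not_or] at hq'
        have hst := del2_stable hπ hS p q
        have hsub : del2 π S p q ⊆ S := sdiff_subset
        have hcard : (del2 π S p q).card + 4 = S.card := card_del2_add_four hπ hπ' hS hp hq'.1 hq'.2.1 hq'.2.2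
        have hne2 : (shellIn π (del2 π S p q) (t + 2 * k) (c + 2 * k)).Nonempty := by
          refine shellIn_del2_nonempty hπ hπ' hS ?_ hp hq'.1 hq'.2.1 hq'.2.2
          rw [show t + 2 * k + 2 = t + 2 * (k + 1) by ring, show c + 2 * k + 2 = c + 2 * (k + 1) by ring]
          exact hne
        refine ih (g₀ * ((ω p - ω q) * (ω (π p) - ω (π q)))) hst c hne2 ?_ ?_
        · intro S' hS' hst' hlt
          exact hρ S' (hS'.trans hsub) hst' (by omega)
        · intro S' hS' hst' heq l hl hlf
          have h := hB S' (hS'.trans hsub) hst' (by omega) (((ω p - ω q) * (ω (π p) - ω (π q))) :: l)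
            (by simp [hl]) (by
              intro g hg
              rcases List.mem_cons.1 hg with rfl | hg
              · exact ⟨p, q, rfl⟩
              · exact hlf g hg)
          rwa [List.prod_cons, ← mul_assoc] at h
      -- pairs with zero factor contribute nothing; the others are at most `ρ^k·B` each
      have hinner : ∀ p ∈ S, ∑ q ∈ S \ {p, π p},
          ν ((g₀ * ((ω p - ω q) * (ω (π p) - ω (π q)))) *
              (fwdDiff 2)^[k] (wlaw π ω (del2 π S p q) (t + 2 * k)) c) ≤
            (((S \ {p, π p}).filter (fun q => (ω p - ω q) * (ω (π p) - ω (π q)) ≠ 0)).card : ℝ) *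
              (ρ ^ k * B) := by
        intro p hp
        rw [← sum_filter_add_sum_filter_not (S \ {p, π p})
          (fun q => (ω p - ω q) * (ω (π p) - ω (π q)) ≠ 0)]
        have hz : ∑ q ∈ (S \ {p, π p}).filter (fun q => ¬(ω p - ω q) * (ω (π p) - ω (π q)) ≠ 0),
            ν ((g₀ * ((ω p - ω q) * (ω (π p) - ω (π q)))) *
              (fwdDiff 2)^[k] (wlaw π ω (del2 π S p q) (t + 2 * k)) c) = 0 := by
          refine sum_eq_zero fun q hq => ?_
          rw [mem_filter, not_not] at hq
          rw [hq.2, mul_zero, zero_mul]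
          exact seminormLike_zero hsmul
        rw [hz, add_zero]
        calc _ ≤ ∑ q ∈ (S \ {p, π p}).filter (fun q => (ω p - ω q) * (ω (π p) - ω (π q)) ≠ 0), ρ ^ k * B :=
              sum_le_sum fun q hq => hIH p hp q (mem_filter.1 hq).1
          _ = _ := by rw [sum_const, nsmul_eq_mul]
      have hpairs := hρ S (Subset.refl S) hS (by omega)
      -- assemble
      rw [hexp, hsmul, abs_neg, abs_of_pos hκ0]
      calc lnorm S.card * ν (∑ p ∈ S, ∑ q ∈ S \ {p, π p},
            (g₀ * ((ω p - ω q) * (ω (π p) - ω (π q)))) * (fwdDiff 2)^[k] (wlaw π ω (del2 π S p q) (t + 2 * k)) c)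
          ≤ lnorm S.card * ∑ p ∈ S, ∑ q ∈ S \ {p, π p},
            ν ((g₀ * ((ω p - ω q) * (ω (π p) - ω (π q)))) * (fwdDiff 2)^[k] (wlaw π ω (del2 π S p q) (t + 2 * k)) c) := by
            refine mul_le_mul_of_nonneg_left ?_ hκ0.le
            exact (seminormLike_sum_le hadd hsmul _ _).trans
              (sum_le_sum fun p _ => seminormLike_sum_le hadd hsmul _ _)
        _ ≤ lnorm S.card * ∑ p ∈ S,
            (((S \ {p, π p}).filter (fun q => (ω p - ω q) * (ω (π p) - ω (π q)) ≠ 0)).card : ℝ) * (ρ ^ k * B) :=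
            mul_le_mul_of_nonneg_left (sum_le_sum hinner) hκ0.le
        _ = lnorm S.card * ((∑ p ∈ S,
            (((S \ {p, π p}).filter (fun q => (ω p - ω q) * (ω (π p) - ω (π q)) ≠ 0)).card : ℝ)) * (ρ ^ k * B)) := by
            rw [sum_mul]
        _ ≤ lnorm S.card * ((2 * ρ * ((S.card : ℝ) * ((S.card : ℝ) - 2))) * (ρ ^ k * B)) :=
            mul_le_mul_of_nonneg_left (mul_le_mul_of_nonneg_right hpairs (by positivity)) hκ0.le
        _ = ρ ^ (k + 1) * B := by
            have hS0 : (S.card : ℝ) ≠ 0 := ne_of_gt (by linarith)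
            have hS2 : (S.card : ℝ) - 2 ≠ 0 := ne_of_gt (by linarith)
            unfold lnorm
            field_simp
            ring

end Bound

/-! ### §5 The coefficient-`ℓ¹` functionals on `ℝ[X]` (one block) and `ℝ[X₁][X₂]` (two blocks) -/

section CoeffL1

open Polynomial

/-- The windowed coefficient `ℓ¹` functional on `ℝ[X]`: `ν_X(P) = Σ_{i∈X} |P_i|` (one block: the `ℓ¹` size on the
window `X` of a signed law encoded as a generating polynomial). [cite: RollinRoss2010, §3 (the smoothness functionals `D_k`)] -/
def coeffAbsSum (X : Finset ℕ) (P : Polynomial ℝ) : ℝ := ∑ i ∈ X, |P.coeff i|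

/-- The windowed coefficient `ℓ¹` functional on `ℝ[X₁][X₂]` (`X₁ = C X` inner, `X₂ = X` outer, as in
`ShellLawWeightedEdgeProduct.prod_blockWeight₂`): `ν_W(P) = Σ_{(i,j)∈W} |(P_j)_i|` (two blocks: the `ℓ¹` size of a
signed joint law on the window `W`). [cite: RollinRoss2010, §3 (the smoothness functionals `D_k`)] -/
def coeffAbsSum₂ (W : Finset (ℕ × ℕ)) (P : Polynomial (Polynomial ℝ)) : ℝ := ∑ ij ∈ W, |(P.coeff ij.2).coeff ij.1|

/-- `ν_X` is subadditive. [cite: RollinRoss2010, §3] -/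
theorem coeffAbsSum_add_le (X : Finset ℕ) (P Q : Polynomial ℝ) :
    coeffAbsSum X (P + Q) ≤ coeffAbsSum X P + coeffAbsSum X Q := by
  unfold coeffAbsSum
  rw [← sum_add_distrib]
  exact sum_le_sum fun i _ => by rw [coeff_add]; exact abs_add_le _ _

/-- `ν_X` is absolutely homogeneous. [cite: RollinRoss2010, §3] -/
theorem coeffAbsSum_smul (X : Finset ℕ) (r : ℝ) (P : Polynomial ℝ) :
    coeffAbsSum X (r • P) = |r| * coeffAbsSum X P := by
  unfold coeffAbsSum
  rw [mul_sum]
  exact sum_congr rfl fun i _ => by rw [coeff_smul, smul_eq_mul, abs_mul]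

/-- `ν_W` is subadditive. [cite: RollinRoss2010, §3] -/
theorem coeffAbsSum₂_add_le (W : Finset (ℕ × ℕ)) (P Q : Polynomial (Polynomial ℝ)) :
    coeffAbsSum₂ W (P + Q) ≤ coeffAbsSum₂ W P + coeffAbsSum₂ W Q := by
  unfold coeffAbsSum₂
  rw [← sum_add_distrib]
  exact sum_le_sum fun ij _ => by rw [coeff_add, coeff_add]; exact abs_add_le _ _

/-- `ν_W` is absolutely homogeneous. [cite: RollinRoss2010, §3] -/
theorem coeffAbsSum₂_smul (W : Finset (ℕ × ℕ)) (r : ℝ) (P : Polynomial (Polynomial ℝ)) :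
    coeffAbsSum₂ W (r • P) = |r| * coeffAbsSum₂ W P := by
  unfold coeffAbsSum₂
  rw [mul_sum]
  exact sum_congr rfl fun ij _ => by rw [coeff_smul, coeff_smul, smul_eq_mul, abs_mul]

variable (hπ : ∀ v, π (π v) = v) (hπ' : ∀ v, π v ≠ v)
include hπ hπ'

/-- **One block, windowed `ℓ¹` form** of `seminorm_fwdDiff_iter_wlaw_le` (`R = ℝ[X]`, any vertex weights
`ω : Fin n → ℝ[X]`, e.g. `ω = X^{[·∈H]}`): the `ℓ¹` mass on the window `X` of `g₀·(Δ_{(2)})^k w̄_S(t+2k)(c)` is at most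
`ρ^k·B` under the pair-count hypothesis (i) and the deleted-law hypothesis (ii).  With `g₀ = (1−X)^{2j}` and all
factors `±(1−X)²` this is the shape of `ShellLawSmoothing.sum_abs_nab2_iter_fwdDiff_iter_le`.
[cite: Rothvoss2017, §2 (PDF p. 6)] [cite: RollinRoss2010, §3] -/
theorem coeffAbsSum_fwdDiff_iter_wlaw_le (X : Finset ℕ) (ω : Fin n → Polynomial ℝ) (t : ℕ) {ρ B : ℝ}
    (hρ0 : 0 ≤ ρ) (hB0 : 0 ≤ B) (k : ℕ) (g₀ : Polynomial ℝ) {S : Finset (Fin n)} (hS : ∀ v ∈ S, π v ∈ S)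
    (c : ℕ) (hne : (shellIn π S (t + 2 * k) (c + 2 * k)).Nonempty)
    (hρ : ∀ S' ⊆ S, (∀ v ∈ S', π v ∈ S') → S.card < S'.card + 4 * k →
        (∑ p ∈ S', (((S' \ {p, π p}).filter
            (fun q => (ω p - ω q) * (ω (π p) - ω (π q)) ≠ 0)).card : ℝ)) ≤
          2 * ρ * ((S'.card : ℝ) * ((S'.card : ℝ) - 2)))
    (hB : ∀ S' ⊆ S, (∀ v ∈ S', π v ∈ S') → S'.card + 4 * k = S.card →
        ∀ l : List (Polynomial ℝ), l.length = k →
          (∀ g ∈ l, ∃ p q : Fin n, g = (ω p - ω q) * (ω (π p) - ω (π q))) →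
          coeffAbsSum X (g₀ * l.prod * wlaw π ω S' t c) ≤ B) :
    coeffAbsSum X (g₀ * (fwdDiff 2)^[k] (wlaw π ω S (t + 2 * k)) c) ≤ ρ ^ k * B :=
  seminorm_fwdDiff_iter_wlaw_le hπ hπ' (coeffAbsSum_add_le X) (coeffAbsSum_smul X) ω t hρ0 hB0 k g₀ hS c hne hρ hB

/-- **Two blocks, windowed `ℓ¹` form** of `seminorm_fwdDiff_iter_wlaw_le` (`R = ℝ[X₁][X₂]`, e.g.
`ω v = C (X^{[v∈H₁]}) · X^{[v∈H₂]}`, `ShellLawWeightedEdgeProduct.prod_blockWeight₂`): the `ℓ¹` mass on the window `W`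
of `g₀·(Δ_{(2)})^k w̄_S(t+2k)(c)` — a signed combination of joint shell laws of `(|U∩H₁|, |U∩H₂|)` — is at most
`ρ^k·B`; the factors are the mixed second differences `(1−X_i)²`, `(X₁−X₂)²`, `(1−X₁)(1−X₂)`, `(1−X_i)(X_j−X_i)`
(cell pnp-psdrank, CG2SYM). [cite: Rothvoss2017, §2 (PDF p. 6)] [cite: RollinRoss2010, §3] -/
theorem coeffAbsSum₂_fwdDiff_iter_wlaw_le (W : Finset (ℕ × ℕ)) (ω : Fin n → Polynomial (Polynomial ℝ)) (t : ℕ)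
    {ρ B : ℝ} (hρ0 : 0 ≤ ρ) (hB0 : 0 ≤ B) (k : ℕ) (g₀ : Polynomial (Polynomial ℝ)) {S : Finset (Fin n)}
    (hS : ∀ v ∈ S, π v ∈ S) (c : ℕ) (hne : (shellIn π S (t + 2 * k) (c + 2 * k)).Nonempty)
    (hρ : ∀ S' ⊆ S, (∀ v ∈ S', π v ∈ S') → S.card < S'.card + 4 * k →
        (∑ p ∈ S', (((S' \ {p, π p}).filter
            (fun q => (ω p - ω q) * (ω (π p) - ω (π q)) ≠ 0)).card : ℝ)) ≤
          2 * ρ * ((S'.card : ℝ) * ((S'.card : ℝ) - 2)))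
    (hB : ∀ S' ⊆ S, (∀ v ∈ S', π v ∈ S') → S'.card + 4 * k = S.card →
        ∀ l : List (Polynomial (Polynomial ℝ)), l.length = k →
          (∀ g ∈ l, ∃ p q : Fin n, g = (ω p - ω q) * (ω (π p) - ω (π q))) →
          coeffAbsSum₂ W (g₀ * l.prod * wlaw π ω S' t c) ≤ B) :
    coeffAbsSum₂ W (g₀ * (fwdDiff 2)^[k] (wlaw π ω S (t + 2 * k)) c) ≤ ρ ^ k * B :=
  seminorm_fwdDiff_iter_wlaw_le hπ hπ' (coeffAbsSum₂_add_le W) (coeffAbsSum₂_smul W) ω t hρ0 hB0 k g₀ hS c hne hρ hB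

end CoeffL1

end ShellStep

end Literature.Combinatorics.Optimization

end
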